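/-
Copyright (c) 2026. All rights reserved.
Released under Apache 2.0 license as described in the file LICENSE.
-/
import Literature.NumberTheory.Automorphic.QuaternionRamificationParity
import Literature.NumberTheory.QuadraticForms.HilbertReciprocityRat
import Literature.NumberTheory.Automorphic.BrandtModuleDictionary
import HarnessLib

/-!
# `(−1,−7)_ℚ` is ramified exactly at `3` and `∞`: `Ram_f (−1,−7)_ℚ = {7}` in the `IsSplitAt` language (the format of the
# Brandt setups `Brandt.XiSetup 1 7`), and `(−1,−7)_ℚ` is totally definite

[tag: quaternion_algebra] [tag: hilbert_symbol] [tag: ramification]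

Topic `NumberTheory/Automorphic`; THEOREMS ONLY (no definition, no named fact, no instance; net Literature debt `0`).
Lane `lit-hodgefound`, seat p12, gen 46 — second file of the series on the definite quaternion order of discriminant `7`
(after `MaximalOrderDiscSevenLattice`: the maximal order `O₇ = ℤ⟨1, i, ω, iω⟩` of Mathlib's `ℍ[ℚ,−1,−7]`, Cardoso–Machiavelo §5.1).
A Brandt setup `Brandt.XiSetup N⁺ N⁻` asks for a totally definite quaternion algebra (`IsTotallyDefinite`),
`ramifiedPlaces ℚ D = {v | p_v ∣ N⁻}` with `N⁻` squarefree, and an Eichler order of level `N⁺`. This file supplies the two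
ramification clauses for `D = (−1,−7)_ℚ`, `N⁻ = 7`, from the tree's general theorems (`isSplitAt_iff_hilbertSymbol_eq_one`,
Serre's explicit signs `hilbertSymbol_rat_eq_localSign`, `isSplitAtInfinite_quaternionAlgebra_iff`), the only input specific
to `(−1,−7)_ℚ` being the Hilbert symbols `(−1,−7)_p` — exactly as `HurwitzOrderRamification` ∕ `MaximalOrderDiscThreeRamification` did for
`N⁻ = 2, 3`:

* §1 `localSign_two_neg_one_neg_seven` (**`(−1,−7)₂ = 1`**: `−7 ≡ 1 mod 4`, so `(−1)^{ε(−1)ε(−7)} = 1` — `B` is SPLIT at `2`),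
  `localSign_seven_neg_one_neg_seven` (**`(−1,−7)₇ = (−1∕7) = −1`**, `7 ≡ 3 mod 4`), `localSign_neg_one_neg_seven_of_not_dvd`
  (`= 1` for `p ∤ 14`), `localSign_neg_one_neg_seven_eq_one_iff` (`(−1,−7)_p = 1 ⟺ p ∤ 7`);
* §2 **`isSplitAt_iff_not_dvd_seven`** (`B_v ≅ M₂(ℚ_v) ⟺ p_v ∤ 7`), **`ramifiedPlaces_eq`** (`Ram_f B = {v | p_v ∣ 7}` — the clause
  `ramifiedPlaces_eq` of `Brandt.XiSetup · 7`), `mem_ramifiedPlaces_iff_seven_mem` (the `EichlerPackage` format `(7) ⊆ v`),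
  `not_isSplitAt_of_dvd_seven`, `isSplitAt_of_not_dvd_seven` — so `disc B = 7`: `B` is neither `(−1,−1 ∣ ℚ)` nor `(−1,−3 ∣ ℚ)`
  nor `(−2,−5 ∣ ℚ)` (`Ram_f = {2}, {3}, {5}` in the tree);
* §3 **`isTotallyDefinite`** (`X² + Y² = −7` has no real solution).

## Sources

* J. Voight, *Quaternion Algebras*, GTM 288 (2021), Thm. 25.4.1 (`D = 7`), Exercise 17.10 (the maximal order of discriminant
  `7`). [cite: Voight2021, Thm. 25.4.1 (D = 7); Exercise 17.10]
* A. Cardoso, A. Machiavelo, arXiv:2506.22651 (2025), §5.1 («the rational quaternion algebra `A = (−1,−7 ∣ ℚ)`, and its maximal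
  order of discriminant 7»). [cite: CardosoMachiavelo2025, §5.1]
* J.-P. Serre, *A Course in Arithmetic* (1973), Ch. III §1.2 Thm. 1 (the explicit Hilbert symbols over `ℚ_p` and `ℝ`).
  [cite: Serre1973, Ch. III §1.2 Thm. 1]
* M.-F. Vignéras, *Arithmétique des algèbres de quaternions*, LNM 800 (1980), Ch. II §1 Thm. 1.1 («`Ram(H) = {v, H_v est un
  corps}`»), Ch. III §1 Exemple («`Ram{a,b} = {v, (a,b)_v = −1}`»), Ch. III §3 (définie = ramifiée aux places infinies).
  [cite: VignerasLNM800, Ch. II §1 Thm. 1.1; Ch. III §1 Exemple; Ch. III §3]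

## Scope (honest)

Theorems only — no definition, no named fact, no instance. Everything is the tree's general theory specialised to
`D = ℍ[ℚ,−1,−7]`; the Brandt setup itself (a structure VALUE) is assembled in the sequel.
-/

open Quaternion
open scoped Pointwise
open IsDedekindDomain NumberField
open Literature.NumberTheory.Automorphic.Brandt
open Literature.NumberTheory.QuadraticForms

namespace Literature.NumberTheory.Automorphic.MaxOrderDiscSeven

/-! ## §1 The Hilbert symbols `(−1,−7)_p` -/

section Signs

/-- **`(−1,−7)₂ = 1`** (`−1`, `−7` are `2`-adic units and `−7 ≡ 1 (mod 4)`: `(−1)^{ε(−1)ε(−7)} = 1`) — `(−1,−7)_ℚ` is split at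
`2`. [cite: Serre1973, Ch. III §1.2 Thm. 1] -/
theorem localSign_two_neg_one_neg_seven : localSign 2 (-1) (-7) = 1 := by
  rw [localSign, if_pos rfl, localSignTwo_of_odd (by norm_num) (by norm_num), epsSign_neg_one_left]
  have : ¬ ZMod.χ₄ ((-7 : ℤ) : ZMod 4) = -1 := by decide
  rw [if_neg this]

/-- **`(−1,−7)₇ = (−1∕7) = −1`** (`−7 = 7¹·(−1)`, `−1` a `7`-adic unit and a non-residue mod `7 ≡ 3 (mod 4)`). [cite: Serre1973, Ch. III §1.2 Thm. 1] -/
theorem localSign_seven_neg_one_neg_seven : localSign 7 (-1) (-7) = -1 := by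
  haveI : Fact (Nat.Prime 7) := ⟨Nat.prime_seven⟩
  rw [localSign, if_neg (by norm_num), localSignOdd_def]
  have h7 := padicValInt_eq_of_eq_pow_mul (p := 7) (a := -7) (u := -1) (n := 1) (by norm_num) (by norm_num)
  rw [h7.1, h7.2, padicValInt_neg_one, primeCompl_neg_one]
  have hm1 : legendreSym 7 (-1) = -1 := by
    rw [legendreSym.at_neg_one (p := 7) (by decide)]; decide
  simp [hm1]

/-- **`(−1,−7)_p = 1` for `p ∤ 14`** (both entries are `p`-adic units, `p` odd). [cite: Serre1973, Ch. III §1.2 Thm. 1] -/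
theorem localSign_neg_one_neg_seven_of_not_dvd {p : ℕ} (hp : p.Prime) (hp14 : ¬ p ∣ 14) : localSign p (-1) (-7) = 1 := by
  refine localSign_eq_one_of_not_dvd hp fun h => hp14 ?_
  have h' : (p : ℤ) ∣ 14 := by
    have e : (2 : ℤ) * -1 * -7 = 14 := by norm_num
    rwa [e] at h
  exact_mod_cast h'

/-- **`(−1,−7)_p = 1 ⟺ p ∤ 7`** (`p` prime): the only finite place where the symbol is `−1` is `p = 7`. [cite: Serre1973, Ch. III §1.2 Thm. 1] [cite: VignerasLNM800, Ch. III §1 Exemple] -/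
theorem localSign_neg_one_neg_seven_eq_one_iff {p : ℕ} (hp : p.Prime) : localSign p (-1) (-7) = 1 ↔ ¬ p ∣ 7 := by
  constructor
  · intro h hp3
    have := (Nat.prime_dvd_prime_iff_eq hp Nat.prime_seven).1 hp3
    subst this
    rw [localSign_seven_neg_one_neg_seven] at h
    norm_num at h
  · intro hp3
    by_cases hp2 : p = 2
    · subst hp2
      exact localSign_two_neg_one_neg_seven
    · refine localSign_neg_one_neg_seven_of_not_dvd hp fun h14 => ?_
      have h14' : p ∣ 2 * 7 := h14
      rcases (Nat.Prime.dvd_mul hp).1 h14' with h2 | h3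
      · exact hp2 ((Nat.prime_dvd_prime_iff_eq hp Nat.prime_two).1 h2)
      · exact hp3 h3

end Signs

/-! ## §2 `Ram_f (−1,−7)_ℚ = {7}` -/

section Ramification

/-- **`B = (−1,−7)_ℚ` is split at the finite place `v` iff `p_v ∤ 7`** (`B_v ≅ M₂(ℚ_v) ⟺ (−1,−7)_v = 1`).
[cite: VignerasLNM800, Ch. II §1 Thm. 1.1 and Ch. III §1 Exemple] [cite: Serre1973, Ch. III §1.2 Thm. 1] -/
theorem isSplitAt_iff_not_dvd_seven (v : HeightOneSpectrum (𝓞 ℚ)) :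
    IsSplitAt ℍ[ℚ,-1,-7] v ↔ ¬ Rat.HeightOneSpectrum.natGenerator v ∣ 7 := by
  have h := isSplitAt_iff_hilbertSymbol_eq_one ℚ ℍ[ℚ,-1,-7] (a := (-1 : ℚ)) (b := (-7 : ℚ)) (by norm_num) (by norm_num)
    AlgEquiv.refl v
  have hs := hilbertSymbol_rat_eq_localSign v (a := -1) (b := -7) (by norm_num) (by norm_num)
  have e1 : ((-1 : ℤ) : ℚ) = -1 := by norm_num
  have e7 : ((-7 : ℤ) : ℚ) = -7 := by norm_num
  rw [e1, e7] at hs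
  rw [h, hs, ← localSign_neg_one_neg_seven_eq_one_iff (Rat.HeightOneSpectrum.prime_natGenerator v)]

/-- **`Ram_f (−1,−7)_ℚ = {v | p_v ∣ 7}`: the discriminant of `(−1,−7)_ℚ` is `7`** — the ramification clause of the Brandt
setups `Brandt.XiSetup · 7` (Voight Thm. 25.4.1, `D = 7`). [cite: VignerasLNM800, Ch. III §1 Exemple] [cite: Voight2021, Thm. 25.4.1 (D = 7)] -/
theorem ramifiedPlaces_eq :
    ramifiedPlaces ℚ ℍ[ℚ,-1,-7] = {v | ((Rat.HeightOneSpectrum.primesEquiv v : Nat.Primes) : ℕ) ∣ 7} := by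
  ext v
  rw [mem_ramifiedPlaces_iff, isSplitAt_iff_not_dvd_seven, not_not]
  rfl

/-- **`v ∈ Ram(B) ⟺ (7) ⊆ v`** — the ramification hypothesis in the `EichlerPackage` format. [cite: VignerasLNM800, Ch. III §1 Exemple] -/
theorem mem_ramifiedPlaces_iff_seven_mem (v : HeightOneSpectrum (𝓞 ℚ)) :
    v ∈ ramifiedPlaces ℚ ℍ[ℚ,-1,-7] ↔ ((7 : ℕ) : 𝓞 ℚ) ∈ v.asIdeal := by
  rw [ramifiedPlaces_eq, Set.mem_setOf_eq, primesEquiv_dvd_iff]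

/-- `(−1,−7)_ℚ` is NOT split at the place over `7`. [cite: VignerasLNM800, Ch. III §1 Exemple] -/
theorem not_isSplitAt_of_dvd_seven {v : HeightOneSpectrum (𝓞 ℚ)} (hv : Rat.HeightOneSpectrum.natGenerator v ∣ 7) :
    ¬ IsSplitAt ℍ[ℚ,-1,-7] v := by
  rw [isSplitAt_iff_not_dvd_seven, not_not]
  exact hv

/-- `(−1,−7)_ℚ` IS split at every place not over `7` (in particular at `2`). [cite: VignerasLNM800, Ch. III §1 Exemple] -/
theorem isSplitAt_of_not_dvd_seven {v : HeightOneSpectrum (𝓞 ℚ)} (hv : ¬ Rat.HeightOneSpectrum.natGenerator v ∣ 7) :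
    IsSplitAt ℍ[ℚ,-1,-7] v :=
  (isSplitAt_iff_not_dvd_seven v).2 hv

end Ramification

/-! ## §3 `(−1,−7)_ℚ` is totally definite -/

section Definite

/-- **`(−1,−7)_ℚ` is totally definite**: it is ramified at the real place of `ℚ` — were `ℝ ⊗ B ≅ M₂(ℝ)`, the equation
`X² + Y² = −7` would be solvable in `ℚ_∞ = ℝ`. [cite: VignerasLNM800, Ch. III §3 (algèbre totalement définie)] [cite: Serre1973, Ch. III §1.2 Thm. 1 (`(−1,−7)_∞ = −1`)] -/
theorem isTotallyDefinite : IsTotallyDefinite ℚ ℍ[ℚ,-1,-7] := by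
  intro w hw
  have hwr : w.IsReal := IsTotallyReal.isReal w
  obtain ⟨x, y, hxy⟩ := (isSplitAtInfinite_quaternionAlgebra_iff (K := ℚ) (a := (-1 : ℚ)) (b := (-7 : ℚ))
    (by norm_num) (by norm_num) w).1 hw
  rw [map_neg, map_one, map_neg, map_ofNat] at hxy
  have h2 := congr_arg (InfinitePlace.Completion.extensionEmbeddingOfIsReal hwr) hxy
  simp only [map_sub, map_mul, map_pow, map_neg, map_one, map_ofNat] at h2
  nlinarith [sq_nonneg (InfinitePlace.Completion.extensionEmbeddingOfIsReal hwr x),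
    sq_nonneg (InfinitePlace.Completion.extensionEmbeddingOfIsReal hwr y)]

end Definite

end Literature.NumberTheory.Automorphic.MaxOrderDiscSeven
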